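import Literature.MathematicalPhysics.QuantumFieldTheory.Balaban1983to89.B8Ineq159FlatCovPrintedRec
import Literature.MathematicalPhysics.QuantumFieldTheory.Balaban1983to89.B7Prop4FlatCarriedLetterOscRec
import Literature.MathematicalPhysics.QuantumFieldTheory.Balaban1983to89.B8FlatCurlOscillationZd

/-!
# `Balaban1983to89.B8Ineq159FlatCovCubeMemberRec` — [Balaban1985RegularSpaces] (1.59) p. 86 ∕ (1.62) p. 87 AT `U₀ = 1` (= [Balaban1985BackgroundPropagators] Thm 3.3) FOR THE
# RECORD's LINEARISED AVERAGING `Q_j(1) = linCovIterZ L 1` ([Balaban1987RG1] (0.4)) ON THE CENTRED CUBE MEMBER `{□_j}` OF (1.131): the named fact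
# **`B8Ineq159FlatCovPrintedRec.Ineq159FlatCubeMemberCovPrintedZ (d+1) (ℓ+1)` PROVED for every odd `L = ℓ+1 ≥ 5`**, by a BOOTSTRAP FROM THE PROVED STRAIGHT TWIN
# `B8Ineq159FlatCubeMemberPrintedRec.ineq159FlatCubeMemberPrintedZ_holds`

statement-level skeleton of published theorems with citation tags; proofs where landed; nothing here is a claim about the Yang–Mills mass gap

CITATION HEADER (lean-in-tree rule).  Cell `pub-ymgap` (HUMAN RULING D-0062), «N05-REC» road, seat `pub-ymgap-dag-n05-cov` g0 (director-ym R509 (a), 2026-08-29: «prove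
`Ineq159FlatCubeMemberCovPrintedZ d L` ∧ `Ineq159FlatDentedCubeMemberCovPrintedZ d L` … if found ⇒ N05-REC crown and the K0⁷ road become UNCONDITIONAL»); the named facts were typed by
dag-n05-e g39 (INTENT-8, `B8Ineq159FlatCovPrintedRec`).  `--kind proof --supports stmt-QuantumFields-20541` (K0⁷; count-neutral).  [6] = [Balaban1985RegularSpaces] (1.55)–(1.59)
p. 86, (1.62) p. 87, (1.31) p. 82, (1.131) p. 99, p. 98; [4] = [Balaban1985BackgroundPropagators] (3.4) p. 391, (3.14)–(3.15) p. 393, Thm 3.3 p. 399; [3] = [Balaban1985Averaging]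
(89)–(92) p. 31, (122)–(127) pp. 36–37; [I] = [Balaban1987RG1] (0.3)–(0.4) pp. 252–253; [B6] = [Balaban1984PropagatorsII] (2.3) p. 224.  REUSED BY NAME: the straight fact and its proof
(`B8Ineq159FlatCubeMemberPrintedRec.{Ineq159FlatCubeMemberPrintedZ, ineq159FlatCubeMemberPrintedZ_holds, cubeLamBPZ, mem_cubeLamBPZ_iff}`, dag-n05-e g38), the identity
`B7Prop4FlatCarriedLetterRec.linCovIterZ_one_eq` (dag-n05-e g37), this seat's `B7Prop4FlatCarriedLetterOscRec.norm_carried_flat_le_osc` and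
`B8FlatCurlOscillationZd.exists_plaqCovDeriv_osc_const`, `B8FlatOperatorsTranslateLocal.near_of_sideTouches`, `B8Eq131CubesRec.{cube_eq, cube_anti}`,
`B8Eq131CubesAdmissibleRec.cubeFam_false_of_le`, `B8Eq119TwistedAxialRec.ctrShift_add`, `BlockAveragingZd.two_mul_ctrShift_add_one`, `B8Eq131Cubes.gs_succ`.

THE PROOF (new; not in print, where the averaging of [3] (89)–(92) has matching frames and `Q_j(1)` IS straight).  The record's flat linearised average is `Ŷ_j + dΘ_j`
(`linCovIterZ_one_eq`), so the straight datum of the twin is the Cov datum up to `‖Θ_j(iηφ)‖` at the two ends of each class bond.  The carried letter kills constant-curl fields on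
centred blocks, hence `‖Θ_j(iηφ)(z)‖ ≤ (ds)²·Σ_{i<j}L^{2i}·osc(d(iηφ))` over the `(ds+2L)L^j`-ball (`norm_carried_flat_le_osc`); the oscillation of the flat plaquette field
`F = D^η_1φ` over that ball is `≤ C(sup|F| + K·η·sup|J|)∕t` by the discrete Campanato estimate on the `t²`-times larger box (`exists_plaqCovDeriv_osc_const`), which lies in
`□_{j−1}` once the annulus is wide (`box_subset_cubeZ_pred`; width `ρL^{j−1}`, p. 98), where `sup|F| ≤ 2G∕(L^{j−1}η)²` with `G` the MAXIMUM OF THE STRAIGHT FACT's OWN GRADIENT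
CONCLUSION (`exists_weighted_max`) and `sup|J| ≤ N∕(L^{j−1}η)³`.  The weights telescope: `‖Θ_j(iηφ)‖ ≤ E(2L²G + t²(ds+2L)L³N)∕t`, `E = (ds)²C` (`norm_carried_iEta_le`).  Feeding the
straight fact the datum `N′ = N + 2E(2L²G + t²(ds+2L)L³N)∕t` bounds `G ≤ B₀N′`; for `t > 8B₀EL²` this is a contraction, `G ≤ 2B₀N(1 + 2E(ds+2L)L³t)`, and `B₀N′ ≤ B₀′N` with
`B₀′ = 2B₀(1 + 2E(ds+2L)L³t)`; the thresholds are the straight fact's with `R₀ ↦ max R₀ ((1 + 4t²(ds+2L))L + 3)`.  `d + 1 = 1` is vacuous (no plaquettes).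

WHAT IS PROVED (sorry-free; proof lane — 0 `def`).  §1 ★ `box_subset_cubeZ_pred` (the Campanato box about a near-`□_j` label lies in `□_{j−1}`).  §2 `bondTouches_of_mem`,
`sideTouches_of_mem`, `not_sideTouches_of_lt_two`, `abs_apply_le_l1`, `exists_near_of_mem_cubeLamBPZ`, ★ `exists_weighted_max`.  §3 `sum_pow_lt_le`, `asum_smul_complex`,
`asum_plaqWord_eq_smul_plaqCovDeriv`, `iEta_eq_smul`, ★★ `norm_carried_iEta_le` (THE KEY ESTIMATE).  §4 `norm_dcovF_one_le`, ★★★ `cov_of_straight`,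
★★★ **`ineq159FlatCubeMemberCovPrintedZ_holds (d ℓ) (hℓ : 4 ≤ ℓ) (hodd : Odd (ℓ+1)) : Ineq159FlatCubeMemberCovPrintedZ (d+1) (ℓ+1)`** — UNCONDITIONAL.
HONEST SCOPE.  One of the two displayed premises of the record crown `gaugedBoundB8DZ_dentedMember_of_cov159` discharged (the dented twin is the sibling file); `HThm4Rec` itself
UNDISCHARGED here; N05 ∕ N07 NOT discharged by this file; COUNT of record unmoved · K numerically unchanged; one finite `𝕋⁴` programme at fixed `ε`, Bałaban AS PRINTED plus the
bootstrap above (ours); nothing continuum ∕ ℝ⁴ ∕ OS ∕ mass-gap ∕ Clay.  NEW file; modifies nothing.  No `instance`, no `notation`, no `sorry`.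
-/

set_option autoImplicit false

noncomputable section

open scoped BigOperators
open Finset

namespace Literature.MathematicalPhysics.QuantumFieldTheory.Balaban1983to89.B8Ineq159FlatCovCubeMemberRec

open B7Prop1Explicit hiding Site
open B7Prop1Explicit renaming Site → SiteZ
open B7Prop1Local (InBox)
open BlockAveragingZd (offZ IdxZ ctrShift l1_offZ_le two_mul_ctrShift_add_one)
open B8Eq119TwistedAxialRec (ctrShift_add)
open B8Eq131Cubes (gs gs_succ)
open B8Eq131CubesRec (sqLoZ sqHiZ inLoZ inHiZ bLoZ bHiZ cubeZ cube_eq)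
open B8Eq131CubesAdmissibleRec (cubeFamZ)
open B8Ineq132 (covDerivFwd BondTouches PlaqTouches)
open B8Eq140Level (SideTouches IsSide)
open B8Eq146AExpansion (iEta plaqCovDeriv plaqCovDeriv_eq_covDerivFwd)
open B8Eq155JBound (Jcur)
open B8Eq138LandauZd (covLap)
open B8Ineq159FlatCubeMemberPrintedRec (cubeLamBPZ mem_cubeLamBPZ_iff)
open B8FlatOperatorsTranslateLocal (near_of_sideTouches)
open B7SectEFLinearisationRec (linQIterZ linCovIterZ rlamZ)
open B7Prop3GaugeCarryRec (lamZ)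
open B7Prop3PureGaugeRec (dcovF dcovF_apply)
open B7Prop4GaugeInductionRec (carryIter carryIter_zero)
open B7Prop4FlatCarriedLetterRec (linCovIterZ_one_eq)
open B7Prop4FlatCarriedLetterOscRec (norm_carried_flat_le_osc)
open B8FlatCurlOscillationZd (plaqCovDeriv_one_apply')
open B7Prop3GeneralTild (tsum_smul)
open B7Prop3GeneralRotated (tsum_one_left)
open B4Eq19LatticeOperators (box mem_box)
open B7Eq78Linearization (conjR conjR_apply)
open B8Eq191FlatStencils (conjR_unitOne)
open B8Ineq159FlatCubeMemberPrintedRec (Ineq159FlatCubeMemberPrintedZ ineq159FlatCubeMemberPrintedZ_holds)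
open B8Ineq159FlatCovPrintedRec (Ineq159FlatCubeMemberCovPrintedZ)

variable {d : ℕ}

/-! ## §1 Geometry: the Campanato box about an endpoint of a class-`j` bond lies inside `□_{j−1}` -/

section Geometry

/-- ★ **THE BOX ABOUT A NEAR-`□_j` LABEL LIES IN `□_{j−1}`** (centred tower, odd `L`, `1 ≤ j ≤ k`): if the level-`j` label `z` is within label-distance `1` of `□_j^{(j)}` and
`L^j + T ≤ ρ·L^{j−1}`, then every fine site `x` with `|x − L^j z|_∞ ≤ T` lies in `□_{j−1}` — the annulus `□_{j−1} ∖ □_j` has width `ρ` level-`(j−1)` blocks («a distance between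
boundaries of these cubes is equal to `R₁M₁Lʲη`», p. 98). [cite: Balaban1985RegularSpaces, p.98, (1.131) p.99; Balaban1987RG1, (0.3) p.252] -/
theorem box_subset_cubeZ_pred {L : ℕ} (hL : Odd L) (a : SiteZ d) (M ρ k j₀ : ℕ) (hjk : j₀ + 1 ≤ k) (T : ℕ)
    (hρ : L ^ (j₀ + 1) + T ≤ ρ * L ^ j₀) (z w : SiteZ d) (hw : InBox (sqLoZ L a ρ k (j₀ + 1)) (sqHiZ L a M ρ k (j₀ + 1)) w) (hzw : ∀ i, |z i - w i| ≤ 1)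
    (x : SiteZ d) (hx : ∀ i, |x i - (L : ℤ) ^ (j₀ + 1) * z i| ≤ T) : x ∈ cubeZ L a M ρ k j₀ := by
  have hj₀k : j₀ ≤ k := by omega
  rw [cube_eq hL hj₀k]
  intro i
  -- the arithmetic letters
  have hL1 : 1 ≤ L := hL.pos
  have hP : (0 : ℤ) < (L : ℤ) ^ j₀ := by positivity
  have hLj : (0 : ℤ) < (L : ℤ) ^ (j₀ + 1) := by positivity
  have hkj : k - j₀ = (k - (j₀ + 1)) + 1 := by omega
  have hgs : (gs L (k - j₀) : ℤ) = (L : ℤ) * gs L (k - (j₀ + 1)) + 1 := by rw [hkj, gs_succ]; push_cast; ring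
  have hck : (ctrShift L k : ℤ) = (L : ℤ) ^ (j₀ + 1) * ctrShift L (k - (j₀ + 1)) + ctrShift L (j₀ + 1) := by
    have h := ctrShift_add hL (k - (j₀ + 1)) (j₀ + 1)
    rwa [Nat.sub_add_cancel hjk] at h
  have hcj : 2 * (ctrShift L (j₀ + 1) : ℤ) + 1 = (L : ℤ) ^ (j₀ + 1) := by exact_mod_cast two_mul_ctrShift_add_one hL (j₀ + 1)
  have hcj0 : (0 : ℤ) ≤ ctrShift L (j₀ + 1) := by positivity
  have hLk : (L : ℤ) ^ k = (L : ℤ) ^ (j₀ + 1) * (L : ℤ) ^ (k - (j₀ + 1)) := by rw [← pow_add, Nat.add_sub_cancel' hjk]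
  have hLsucc : (L : ℤ) ^ (j₀ + 1) = (L : ℤ) * (L : ℤ) ^ j₀ := by rw [pow_succ, mul_comm]
  have hρ' : (L : ℤ) ^ (j₀ + 1) + T ≤ (ρ : ℤ) * (L : ℤ) ^ j₀ := by exact_mod_cast hρ
  -- the hypotheses at coordinate `i`
  obtain ⟨hw1, hw2⟩ := hw i
  simp only [sqLoZ, sqHiZ, bLoZ, bHiZ] at hw1 hw2
  have hz := hzw i
  have hxz := hx i
  rw [abs_le] at hz hxz
  simp only [bLoZ, bHiZ]
  -- products with `L^{j}`
  have h1 : (L : ℤ) ^ (j₀ + 1) * ((L : ℤ) ^ (k - (j₀ + 1)) * a i - ctrShift L (k - (j₀ + 1)) - (ρ * gs L (k - (j₀ + 1)) : ℕ)) ≤ (L : ℤ) ^ (j₀ + 1) * w i :=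
    mul_le_mul_of_nonneg_left hw1 hLj.le
  have h2 : (L : ℤ) ^ (j₀ + 1) * w i ≤ (L : ℤ) ^ (j₀ + 1) * ((L : ℤ) ^ (k - (j₀ + 1)) * (a i + M) - 1 - ctrShift L (k - (j₀ + 1)) + (ρ * gs L (k - (j₀ + 1)) : ℕ)) :=
    mul_le_mul_of_nonneg_left hw2 hLj.le
  have h3 : (L : ℤ) ^ (j₀ + 1) * (w i - 1) ≤ (L : ℤ) ^ (j₀ + 1) * z i := mul_le_mul_of_nonneg_left (by linarith) hLj.le
  have h4 : (L : ℤ) ^ (j₀ + 1) * z i ≤ (L : ℤ) ^ (j₀ + 1) * (w i + 1) := mul_le_mul_of_nonneg_left (by linarith) hLj.le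
  push_cast at h1 h2 ⊢
  rw [hgs, hck, hLk]
  rw [hLsucc] at h1 h2 h3 h4 hxz hcj ⊢
  constructor
  · linarith [h1, h3, hxz.1, hρ', hcj, hcj0]
  · linarith [h2, h4, hxz.2, hρ', hcj, hcj0]

end Geometry

/-! ## §2 Bookkeeping: touch predicates from membership, class-bond endpoints, the finite maximum of the weighted gradients -/

section Bookkeeping

/-- A bond starting inside `S` touches `S`. [cite: Balaban1985RegularSpaces, p.77 (bond convention before (1.5))] -/
theorem bondTouches_of_mem {S : Set (SiteZ d)} {y : SiteZ d} (hy : y ∈ S) (τ : Fin d) : BondTouches S y τ := Or.inl hy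

/-- A bond starting inside `S` is a side of a plaquette touching `S` (`d ≥ 2`). [cite: Balaban1985RegularSpaces, p.77 (plaquette convention before (1.5))] -/
theorem sideTouches_of_mem (hd : 2 ≤ d) {S : Set (SiteZ d)} {y : SiteZ d} (hy : y ∈ S) (τ : Fin d) : SideTouches S y τ := by
  haveI : Nontrivial (Fin d) := Fin.nontrivial_iff_two_le.mpr hd
  obtain ⟨ν, hν⟩ := exists_ne τ
  exact ⟨y, τ, ν, Ne.symm hν, Or.inl hy, Or.inl ⟨rfl, rfl⟩⟩

/-- In `d ≤ 1` no bond is a side of a plaquette (two distinct directions are needed). [cite: Balaban1985RegularSpaces, p.77 (plaquette convention before (1.5))] -/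
theorem not_sideTouches_of_lt_two (hd : d < 2) (S : Set (SiteZ d)) (y : SiteZ d) (τ : Fin d) : ¬ SideTouches S y τ := by
  rintro ⟨z, κ, ν, hκν, -, -⟩
  haveI : Subsingleton (Fin d) := by
    rcases Nat.lt_succ_iff.mp hd |>.eq_or_lt with h | h
    · subst h; infer_instance
    · have : d = 0 := by omega
      subst this; infer_instance
  exact hκν (Subsingleton.elim κ ν)

/-- A coordinate is at most the `|·|₁`-norm. [folklore] [cite: Balaban1985Averaging, p.24 (bookkeeping)] -/
theorem abs_apply_le_l1 (v : SiteZ d) (i : Fin d) : |v i| ≤ (l1 v : ℤ) := by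
  unfold l1
  have h : (v i).natAbs ≤ ∑ κ, (v κ).natAbs := Finset.single_le_sum (f := fun κ => (v κ).natAbs) (fun _ _ => Nat.zero_le _) (Finset.mem_univ i)
  have h' : ((v i).natAbs : ℤ) ≤ ((∑ κ, (v κ).natAbs : ℕ) : ℤ) := by exact_mod_cast h
  rwa [Int.natCast_natAbs] at h'

/-- **Both endpoints of a bond of print's class `cubeLamBPZ … m j` are within label-distance `1` of `□_j^{(j)}`** (one of them lies in it). [cite: Balaban1984PropagatorsII, (2.3) p.224; Balaban1985RegularSpaces, (1.31) p.82] -/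
theorem exists_near_of_mem_cubeLamBPZ {L : ℕ} {a : SiteZ d} {M ρ k m j : ℕ} {c : SiteZ d × Fin d} (hc : c ∈ cubeLamBPZ L a M ρ k m j) :
    ∃ w, InBox (sqLoZ L a ρ k j) (sqHiZ L a M ρ k j) w ∧ (∀ i, |c.1 i - w i| ≤ 1) ∧ (∀ i, |(c.1 + e c.2) i - w i| ≤ 1) := by
  have he : ∀ i, |(e c.2 : SiteZ d) i| ≤ 1 := fun i => by rw [e_apply]; split_ifs <;> simp
  rcases ((mem_cubeLamBPZ_iff L a M ρ k m j c).1 hc).2.1 with h | h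
  · exact ⟨c.1, h, fun i => by simp, fun i => by simpa using he i⟩
  · refine ⟨c.1 + e c.2, h, fun i => ?_, fun i => by simp⟩
    rw [show c.1 i - (c.1 + e c.2) i = -((e c.2 : SiteZ d) i) by simp, abs_neg]
    exact he i

/-- ★ **THE FINITE MAXIMUM OF THE WEIGHTED GRADIENTS** (the bootstrap quantity): over `j ≤ m ≤ k` and the bonds side-touching `□_j` (a finite set — every such bond is within
distance `1` of `□_j ⊆ □₀`), the weighted forward derivatives `(L^jη)²‖D^η_{1,ν}φ_τ(y)‖` have a least upper bound `G ≥ 0`. [cite: Balaban1985RegularSpaces, (1.59) p.86, (1.62) p.87, p.98] -/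
theorem exists_weighted_max {L : ℕ} (hL : Odd L) (η : ℝ) (a : SiteZ (d + 1)) (M ρ k m : ℕ) (hmk : m ≤ k) (φ : SiteZ (d + 1) → Fin (d + 1) → ℂ) :
    ∃ G : ℝ, 0 ≤ G ∧
      (∀ j, j ≤ m → ∀ (y : SiteZ (d + 1)) (τ ν : Fin (d + 1)), SideTouches (cubeFamZ false L a M ρ k j) y τ →
        ((L : ℝ) ^ j * η) ^ 2 * ‖covDerivFwd η (1 : SiteZ (d + 1) → Fin (d + 1) → ℂˣ) ν (fun x => φ x τ) y‖ ≤ G) ∧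
      (∀ G' : ℝ, 0 ≤ G' → (∀ j, j ≤ m → ∀ (y : SiteZ (d + 1)) (τ ν : Fin (d + 1)), SideTouches (cubeFamZ false L a M ρ k j) y τ →
        ((L : ℝ) ^ j * η) ^ 2 * ‖covDerivFwd η (1 : SiteZ (d + 1) → Fin (d + 1) → ℂˣ) ν (fun x => φ x τ) y‖ ≤ G') → G ≤ G') := by
  classical
  -- the finite index set
  set B : Finset (SiteZ (d + 1)) := Fintype.piFinset fun i => Finset.Icc (sqLoZ L a ρ k 0 i - 1) (sqHiZ L a M ρ k 0 i + 1) with hB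
  set s : Finset (ℕ × SiteZ (d + 1) × Fin (d + 1) × Fin (d + 1)) := (Finset.range (m + 1)) ×ˢ (B ×ˢ (Finset.univ ×ˢ Finset.univ)) with hs
  set g : ℕ × SiteZ (d + 1) × Fin (d + 1) × Fin (d + 1) → ℝ := fun p =>
    if SideTouches (cubeFamZ false L a M ρ k p.1) p.2.1 p.2.2.1 then
      ((L : ℝ) ^ p.1 * η) ^ 2 * ‖covDerivFwd η (1 : SiteZ (d + 1) → Fin (d + 1) → ℂˣ) p.2.2.2 (fun x => φ x p.2.2.1) p.2.1‖ else 0 with hg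
  have hg0 : ∀ p, 0 ≤ g p := fun p => by rw [hg]; dsimp only; split_ifs <;> positivity
  -- every side-touching bond is indexed by `s`
  have hmem : ∀ j, j ≤ m → ∀ (y : SiteZ (d + 1)) (τ ν : Fin (d + 1)), SideTouches (cubeFamZ false L a M ρ k j) y τ → (j, y, τ, ν) ∈ s := by
    intro j hj y τ ν hside
    obtain ⟨⟨s₀, hs₀, hclose⟩, -⟩ := near_of_sideTouches hside
    rw [B8Eq131CubesAdmissibleRec.cubeFam_false_of_le L a M ρ (hj.trans hmk)] at hs₀
    have hs₀0 : s₀ ∈ cubeZ L a M ρ k 0 := B8Eq131CubesRec.cube_anti hL (Nat.zero_le j) (hj.trans hmk) hs₀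
    have hbox : InBox (sqLoZ L a ρ k 0) (sqHiZ L a M ρ k 0) s₀ := hs₀0
    simp only [hs, Finset.mem_product, Finset.mem_range, Finset.mem_univ, and_true, hB, Fintype.mem_piFinset, Finset.mem_Icc]
    refine ⟨Nat.lt_succ_of_le hj, fun i => ?_⟩
    have h1 := hclose i
    obtain ⟨h2, h3⟩ := hbox i
    rw [abs_le] at h1
    constructor <;> linarith
  have hval : ∀ j (y : SiteZ (d + 1)) (τ ν : Fin (d + 1)), SideTouches (cubeFamZ false L a M ρ k j) y τ →
      g (j, y, τ, ν) = ((L : ℝ) ^ j * η) ^ 2 * ‖covDerivFwd η (1 : SiteZ (d + 1) → Fin (d + 1) → ℂˣ) ν (fun x => φ x τ) y‖ := by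
    intro j y τ ν hside; rw [hg]; dsimp only; rw [if_pos hside]
  by_cases hne : s.Nonempty
  · obtain ⟨p, hp, hmax⟩ := Finset.exists_max_image s g hne
    refine ⟨g p, hg0 p, fun j hj y τ ν hside => ?_, fun G' hG' hub => ?_⟩
    · rw [← hval j y τ ν hside]; exact hmax _ (hmem j hj y τ ν hside)
    · rw [hg]; dsimp only
      split_ifs with hside
      · have hjm : p.1 ≤ m := Nat.lt_succ_iff.mp (Finset.mem_range.mp (Finset.mem_product.mp hp).1)
        exact hub p.1 hjm p.2.1 p.2.2.1 p.2.2.2 hside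
      · exact hG'
  · refine ⟨0, le_rfl, fun j hj y τ ν hside => absurd ⟨_, hmem j hj y τ ν hside⟩ hne, fun G' hG' _ => hG'⟩

end Bookkeeping

/-! ## §3 The KEY estimate: the carried letter of `iηφ` at an endpoint of a class-`j` bond, `j ≥ 1` -/

section Key

/-- `Σ_{i<j} q^i ≤ q^j` for `q ≥ 2`. [folklore] [cite: Balaban1985Averaging, (127) p.37 (bookkeeping)] -/
theorem sum_pow_lt_le {q : ℝ} (hq : 2 ≤ q) : ∀ j : ℕ, ∑ i ∈ range j, q ^ i ≤ q ^ j
  | 0 => by simp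
  | j + 1 => by
    rw [Finset.sum_range_succ, pow_succ]
    have ih := sum_pow_lt_le hq j
    have hqj : 0 ≤ q ^ j := by positivity
    nlinarith

/-- `asum` is `ℂ`-homogeneous (via `tsum 1 = asum`). [cite: Balaban1985Averaging, p.24 (bookkeeping)] -/
theorem asum_smul_complex (c : ℂ) (A : SiteZ d → Fin d → ℂ) (x : SiteZ d) (w : List (Letter d)) : asum (c • A) x w = c • asum A x w := by
  rw [← tsum_one_left, ← tsum_one_left, tsum_smul]

/-- The plaquette functional of `φ` is `η` times the flat plaquette derivative: `φ(∂p_{μν}(x)) = η·(D^η_1φ)(p_{μν}(x))` (`η ≠ 0`). [cite: Balaban1985BackgroundPropagators, (3.4) p.391] -/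
theorem asum_plaqWord_eq_smul_plaqCovDeriv {η : ℝ} (hη : η ≠ 0) (φ : SiteZ d → Fin d → ℂ) (x : SiteZ d) (μ ν : Fin d) :
    asum φ x (plaqWord μ ν) = (η : ℝ) • plaqCovDeriv η (1 : SiteZ d → Fin d → ℂˣ) φ μ ν x := by
  rw [plaqCovDeriv_one_apply', smul_smul, mul_inv_cancel₀ hη, one_smul, asum_plaqWord]

/-- `iEta η φ = (iη) • φ`. [cite: Balaban1985RegularSpaces, (1.46) p.84 (bookkeeping)] -/
theorem iEta_eq_smul (η : ℝ) (φ : SiteZ d → Fin d → ℂ) : iEta η φ = ((Complex.I * η : ℂ)) • φ := by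
  funext y κ; rfl

/-- ★★ **THE KEY ESTIMATE.**  Let `L = 2s+1 ≥ 3`, `d ≥ 2`, `j = j₀+1 ≤ m ≤ k`, `t ≥ 1`, and suppose the annulus is wide: `L^j + (4t²(ds+2L)L^j + 3) ≤ ρL^{j₀}`.  If `G` bounds the weighted
gradients `(L^iη)²‖D^η_{1,ν}φ_τ‖` on the bonds side-touching `□_i` (`i ≤ m`), `N` bounds `(L^iη)³‖J(φ)‖` on the bonds touching `□_i`, and `C` is the oscillation constant of
`B8FlatCurlOscillationZd.exists_plaqCovDeriv_osc_const`, then at every level-`j` label `z` within label-distance `1` of `□_j^{(j)}`: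
`‖Θ_j(iηφ)(z)‖ ≤ (d·s)²·C·(2L²·G + t²(ds+2L)L³·N)∕t` — the carried letter kills the constant part of the curl (`norm_carried_flat_le_osc`), the oscillation of the curl over the
`(ds+2L)L^j`-ball is controlled by the Campanato estimate on the `t²`-times larger box (which lies in `□_{j−1}`, where `G`, `N` control `D^η_1φ` and `J`), and the weights telescope.
[cite: Balaban1985RegularSpaces, (1.59) p.86, (1.62) p.87, p.98; Balaban1985Averaging, (127) p.37; Balaban1987RG1, (0.3)–(0.4) pp.252–253] -/
theorem norm_carried_iEta_le (hd : 2 ≤ d) {L s : ℕ} (hLs : L = 2 * s + 1) (hs : 1 ≤ s) (hL : Odd L)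
    {C : ℝ} (hC0 : 0 ≤ C)
    (hC : ∀ (K : ℕ), 3 ≤ K → ∀ (η : ℝ), 0 < η → ∀ (A : SiteZ d → Fin d → ℂ) (a : SiteZ d) (Mu m : ℝ), 0 ≤ Mu → 0 ≤ m →
      (∀ y ∈ box a (4 * (K : ℤ) + 2), ∀ κ ν, ‖plaqCovDeriv η (1 : SiteZ d → Fin d → ℂˣ) A κ ν y‖ ≤ Mu) →
      (∀ y ∈ box a (4 * (K : ℤ) + 2), ∀ κ, ‖Jcur η (1 : SiteZ d → Fin d → ℂˣ) A κ y‖ ≤ m) →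
      ∀ (μ ν : Fin d) (x' : SiteZ d) (ρ₀ : ℕ), 1 ≤ ρ₀ → ρ₀ ≤ K → x' ∈ box a (ρ₀ : ℤ) →
        ‖plaqCovDeriv η (1 : SiteZ d → Fin d → ℂˣ) A μ ν x' - plaqCovDeriv η (1 : SiteZ d → Fin d → ℂˣ) A μ ν a‖ ≤ C * (Mu + K * (η * m)) * Real.sqrt ((ρ₀ : ℝ) / K))
    {η : ℝ} (hη : 0 < η) (φ : SiteZ d → Fin d → ℂ) (a : SiteZ d) (M ρ k m : ℕ) (hmk : m ≤ k)
    {N : ℝ} (hN : 0 ≤ N)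
    (hJ : ∀ i, i ≤ m → ∀ (y : SiteZ d) (τ : Fin d), BondTouches (cubeFamZ false L a M ρ k i) y τ → ((L : ℝ) ^ i * η) ^ 3 * ‖Jcur η (1 : SiteZ d → Fin d → ℂˣ) φ τ y‖ ≤ N)
    {G : ℝ} (hG0 : 0 ≤ G)
    (hG : ∀ i, i ≤ m → ∀ (y : SiteZ d) (τ ν : Fin d), SideTouches (cubeFamZ false L a M ρ k i) y τ →
      ((L : ℝ) ^ i * η) ^ 2 * ‖covDerivFwd η (1 : SiteZ d → Fin d → ℂˣ) ν (fun x => φ x τ) y‖ ≤ G)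
    (t : ℕ) (ht : 1 ≤ t) {j₀ : ℕ} (hjm : j₀ + 1 ≤ m)
    (hρ : L ^ (j₀ + 1) + (4 * (t ^ 2 * ((d * s + 2 * L) * L ^ (j₀ + 1))) + 3) ≤ ρ * L ^ j₀)
    (z w : SiteZ d) (hw : InBox (sqLoZ L a ρ k (j₀ + 1)) (sqHiZ L a M ρ k (j₀ + 1)) w) (hzw : ∀ i, |z i - w i| ≤ 1) :
    ‖carryIter (fun _ θ w' => rlamZ L (1 : SiteZ d → Fin d → ℂˣ) θ ((L : ℤ) • w')) (fun _ A w' => lamZ L (1 : SiteZ d → Fin d → ℂˣ) A ((L : ℤ) • w'))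
        (linQIterZ L (iEta η φ)) (j₀ + 1) z‖
      ≤ ((d : ℝ) * s) ^ 2 * C * (2 * (L : ℝ) ^ 2 * G + (t : ℝ) ^ 2 * ((d : ℝ) * s + 2 * L) * (L : ℝ) ^ 3 * N) / t := by
  -- ### the letters
  have hjk : j₀ + 1 ≤ k := hjm.trans hmk
  have hj₀m : j₀ ≤ m := (Nat.le_succ j₀).trans hjm
  have hL3 : 3 ≤ L := by omega
  have hLpos : 0 < L := by omega
  set ρ₀ : ℕ := (d * s + 2 * L) * L ^ (j₀ + 1) with hρ₀
  set K : ℕ := t ^ 2 * ρ₀ with hK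
  have hLj1 : 1 ≤ L ^ (j₀ + 1) := Nat.one_le_pow _ _ hLpos
  have hρ₀6 : 6 ≤ ρ₀ := by
    have h1 : 6 ≤ d * s + 2 * L := by omega
    calc 6 = 6 * 1 := by norm_num
      _ ≤ (d * s + 2 * L) * L ^ (j₀ + 1) := Nat.mul_le_mul h1 hLj1
  have ht2 : 1 ≤ t ^ 2 := Nat.one_le_pow _ _ (by omega)
  have hρ₀K : ρ₀ ≤ K := by rw [hK]; exact Nat.le_mul_of_pos_left _ (by omega)
  have hK3 : 3 ≤ K := le_trans (by omega) hρ₀K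
  have hρ₀1 : 1 ≤ ρ₀ := le_trans (by norm_num) hρ₀6
  -- the centre `y = L^j z` and the Campanato box inside `□_{j₀}`
  set y : SiteZ d := ((L : ℤ) ^ (j₀ + 1)) • z with hy
  have hy_apply : ∀ i, y i = (L : ℤ) ^ (j₀ + 1) * z i := fun i => by rw [hy, Pi.smul_apply, smul_eq_mul]
  have hinbox : ∀ x : SiteZ d, x ∈ box y (4 * (K : ℤ) + 2) → x ∈ cubeFamZ false L a M ρ k j₀ := by
    intro x hx
    rw [B8Eq131CubesAdmissibleRec.cubeFam_false_of_le L a M ρ (hj₀m.trans hmk)]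
    refine box_subset_cubeZ_pred hL a M ρ k j₀ hjk (4 * (t ^ 2 * ((d * s + 2 * L) * L ^ (j₀ + 1))) + 3) hρ z w hw hzw x fun i => ?_
    have h := (mem_box.1 hx) i
    rw [hy_apply] at h
    have hKz : (K : ℤ) = (t : ℤ) ^ 2 * (((d : ℤ) * s + 2 * L) * (L : ℤ) ^ (j₀ + 1)) := by rw [hK, hρ₀]; push_cast; ring
    push_cast
    linarith
  -- the level-`j₀` weights
  set W : ℝ := (L : ℝ) ^ j₀ * η with hW
  have hW0 : 0 < W := by positivity
  set Mu : ℝ := 2 * G / W ^ 2 with hMu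
  set mJ : ℝ := N / W ^ 3 with hmJ
  have hMu0 : 0 ≤ Mu := by positivity
  have hmJ0 : 0 ≤ mJ := by positivity
  have hF : ∀ x ∈ box y (4 * (K : ℤ) + 2), ∀ κ ν, ‖plaqCovDeriv η (1 : SiteZ d → Fin d → ℂˣ) φ κ ν x‖ ≤ Mu := by
    intro x hx κ ν
    have hxΩ := hinbox x hx
    have h1 := hG j₀ hj₀m x ν κ (sideTouches_of_mem hd hxΩ ν)
    have h2 := hG j₀ hj₀m x κ ν (sideTouches_of_mem hd hxΩ κ)
    rw [plaqCovDeriv_eq_covDerivFwd]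
    have hW2 : 0 < W ^ 2 := by positivity
    rw [hMu, le_div_iff₀ hW2]
    calc ‖covDerivFwd η 1 κ (fun y => φ y ν) x - covDerivFwd η 1 ν (fun y => φ y κ) x‖ * W ^ 2
        ≤ (‖covDerivFwd η 1 κ (fun y => φ y ν) x‖ + ‖covDerivFwd η 1 ν (fun y => φ y κ) x‖) * W ^ 2 :=
          mul_le_mul_of_nonneg_right (norm_sub_le _ _) hW2.le
      _ ≤ 2 * G := by rw [hW] at *; nlinarith [h1, h2]
  have hJ' : ∀ x ∈ box y (4 * (K : ℤ) + 2), ∀ κ, ‖Jcur η (1 : SiteZ d → Fin d → ℂˣ) φ κ x‖ ≤ mJ := by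
    intro x hx κ
    have h1 := hJ j₀ hj₀m x κ (bondTouches_of_mem (hinbox x hx) κ)
    have hW3 : 0 < W ^ 3 := by positivity
    rw [hmJ, le_div_iff₀ hW3, mul_comm]
    exact h1
  -- the oscillation of the flat plaquette derivative over the `ρ₀`-ball
  have hosc : ∀ (x : SiteZ d) (μ ν : Fin d), l1 (x - y) ≤ ρ₀ →
      ‖plaqCovDeriv η (1 : SiteZ d → Fin d → ℂˣ) φ μ ν x - plaqCovDeriv η (1 : SiteZ d → Fin d → ℂˣ) φ μ ν y‖ ≤ C * (Mu + K * (η * mJ)) * (1 / t) := by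
    intro x μ ν hx
    have hxbox : x ∈ box y (ρ₀ : ℤ) := by
      rw [mem_box]; intro i
      exact (abs_apply_le_l1 (x - y) i).trans (by exact_mod_cast hx)
    have h := hC K hK3 η hη φ y Mu mJ hMu0 hmJ0 hF hJ' μ ν x ρ₀ hρ₀1 hρ₀K hxbox
    have hsqrt : Real.sqrt ((ρ₀ : ℝ) / K) = 1 / t := by
      rw [hK]; push_cast
      have hρ₀r : (0 : ℝ) < ρ₀ := by exact_mod_cast hρ₀1
      have htr : (0 : ℝ) < t := by exact_mod_cast ht
      rw [show (ρ₀ : ℝ) / ((t : ℝ) ^ 2 * ρ₀) = (1 / t) ^ 2 by field_simp, Real.sqrt_sq (by positivity)]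
    rwa [hsqrt] at h
  -- the oscillation of the curl of `iηφ` itself
  set Mosc : ℝ := η * (η * (C * (Mu + K * (η * mJ)) * (1 / t))) with hMosc
  have hMosc0 : 0 ≤ Mosc := by positivity
  have hM : ∀ (x : SiteZ d) (μ ν : Fin d), l1 (x - y) ≤ ρ₀ → ‖asum (iEta η φ) x (plaqWord μ ν) - asum (iEta η φ) y (plaqWord μ ν)‖ ≤ Mosc := by
    intro x μ ν hx
    rw [iEta_eq_smul, asum_smul_complex, asum_smul_complex, asum_plaqWord_eq_smul_plaqCovDeriv hη.ne', asum_plaqWord_eq_smul_plaqCovDeriv hη.ne', ← smul_sub, ← smul_sub,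
      norm_smul, norm_smul, Complex.norm_mul, Complex.norm_I, one_mul, Complex.norm_real, Real.norm_of_nonneg hη.le]
    exact mul_le_mul_of_nonneg_left (mul_le_mul_of_nonneg_left (hosc x μ ν hx) hη.le) hη.le
  -- the carried letter of `iηφ` by the oscillation form of the curvature bound
  have hz : l1 (((L : ℤ) ^ (j₀ + 1)) • z - y) + (d * s + 2 * L) * L ^ (j₀ + 1) ≤ ρ₀ := by rw [hy, sub_self]; simp [l1, hρ₀]
  have hΘ := norm_carried_flat_le_osc L hLs hs (iEta η φ) y ρ₀ hMosc0 hM (j₀ + 1) z hz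
  refine hΘ.trans ?_
  -- ### arithmetic: the weights telescope
  have hLr : (2 : ℝ) ≤ (L : ℝ) ^ 2 := by
    have : (3 : ℝ) ≤ L := by exact_mod_cast hL3
    nlinarith
  have hgeom := sum_pow_lt_le hLr (j₀ + 1)
  have hds : 0 ≤ ((d : ℝ) * s) ^ 2 := by positivity
  calc ((d : ℝ) * s) ^ 2 * Mosc * ∑ i ∈ range (j₀ + 1), ((L : ℝ) ^ 2) ^ i
      ≤ ((d : ℝ) * s) ^ 2 * Mosc * ((L : ℝ) ^ 2) ^ (j₀ + 1) := mul_le_mul_of_nonneg_left hgeom (by positivity)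
    _ = ((d : ℝ) * s) ^ 2 * C * (2 * (L : ℝ) ^ 2 * G + (t : ℝ) ^ 2 * ((d : ℝ) * s + 2 * L) * (L : ℝ) ^ 3 * N) / t := by
      rw [hMosc, hMu, hmJ, hK, hρ₀, hW]
      push_cast
      have hLr0 : (L : ℝ) ≠ 0 := by exact_mod_cast hLpos.ne'
      have hη0 : η ≠ 0 := hη.ne'
      have htr : (t : ℝ) ≠ 0 := by exact_mod_cast (show t ≠ 0 by omega)
      have hpow : ((L : ℝ) ^ 2) ^ (j₀ + 1) = ((L : ℝ) ^ j₀) ^ 2 * (L : ℝ) ^ 2 := by ring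
      rw [hpow]
      field_simp
      ring

end Key

/-! ## §4 THE BOOTSTRAP: the straight fact ⟹ the Cov fact -/

section Bootstrap

/-- **The coarse gradient of the carried letter at a bond, by its two point values** (flat background: `conjR 1 = id`).
[cite: Balaban1985Averaging, (55)–(56) p.27, (93) p.31] -/
theorem norm_dcovF_one_le (Θ : SiteZ d → ℂ) (x : SiteZ d) (ν : Fin d) :
    ‖dcovF (1 : SiteZ d → Fin d → ℂˣ) Θ x ν‖ ≤ ‖Θ x‖ + ‖Θ (x + e ν)‖ := by
  rw [dcovF_apply, Pi.one_apply, Pi.one_apply, conjR_unitOne]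
  exact norm_sub_le _ _

/-- ★★★ **THE BOOTSTRAP: `Ineq159FlatCubeMemberPrintedZ (d+1) (ℓ+1) → Ineq159FlatCubeMemberCovPrintedZ (d+1) (ℓ+1)`** (odd `ℓ+1 ≥ 5`).  Given the hypotheses of the Cov fact with
datum `N`, let `G` be the maximum of the straight fact's own gradient conclusion `(L^jη)²‖D^η_1φ‖` over the side-touching bonds (`exists_weighted_max`).  By
`linCovIterZ_one_eq` and the KEY estimate the STRAIGHT datum holds with `N′ = N + 2E(2L²G + t²(ds+2L)L³N)∕t` (`E = (ds)²C`), so the straight fact bounds `G ≤ B₀N′`; with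
`t > 8B₀EL²` this is a contraction: `G ≤ 2B₀N(1 + 2E(ds+2L)L³t)` and `B₀N′ ≤ B₀′N`, `B₀′ = 2B₀(1 + 2E(ds+2L)L³t)`.  Thresholds: the straight fact's, with `R₀ ↦ max R₀ ((1 + 4t²(ds+2L))L + 3)`
(annulus width).  The case `d+1 = 1` is vacuous (no plaquettes). [cite: Balaban1985RegularSpaces, (1.59) p.86, (1.62) p.87, (1.56) p.86, p.98; Balaban1985BackgroundPropagators, Thm 3.3 p.399;
Balaban1985Averaging, (127) p.37; Balaban1987RG1, (0.3)–(0.4) pp.252–253] -/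
theorem cov_of_straight (d ℓ : ℕ) (hℓ : 4 ≤ ℓ) (hodd : Odd (ℓ + 1)) (hS : Ineq159FlatCubeMemberPrintedZ (d + 1) (ℓ + 1)) :
    Ineq159FlatCubeMemberCovPrintedZ (d + 1) (ℓ + 1) := by
  classical
  -- ### `d + 1 = 1`: no bond is a side of a plaquette, the conclusion is vacuous
  rcases Nat.eq_zero_or_pos d with hd0 | hdpos
  · subst hd0
    refine ⟨1, 0, 0, 0, 0, one_pos, ?_⟩
    intro η hη a M ρ k s R hk hM0 hρdiv hMdiv hRρ hR0 hN01 hρ0 m hm1 hmk φ hLan hsupp N hN0 hJ hQ hout j hjm y τ hside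
    exact absurd hside (not_sideTouches_of_lt_two (by norm_num) _ _ _)
  have hd2 : 2 ≤ d + 1 := by omega
  -- ### the letters
  have hoddL : Odd (ℓ + 1) := hodd
  obtain ⟨sL, hsL⟩ := hodd
  have hsL2 : 2 ≤ sL := by omega
  have hLs : ℓ + 1 = 2 * sL + 1 := by omega
  obtain ⟨B₀, ρ₀, M₀, N₀, R₀, hB₀, HS⟩ := hS
  obtain ⟨C, hC0, hC⟩ := B8FlatCurlOscillationZd.exists_plaqCovDeriv_osc_const (d + 1) (by omega)
  set E : ℝ := (((d + 1 : ℕ) : ℝ) * sL) ^ 2 * C with hE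
  have hE0 : 0 ≤ E := by positivity
  set ρfac : ℕ := (d + 1) * sL + 2 * (ℓ + 1) with hρfac
  set t : ℕ := ⌈8 * B₀ * E * ((ℓ : ℝ) + 1) ^ 2⌉₊ + 1 with ht
  have ht1 : 1 ≤ t := by omega
  have htr : (0 : ℝ) < t := by exact_mod_cast ht1
  have ht8 : 8 * B₀ * E * ((ℓ : ℝ) + 1) ^ 2 ≤ t := by
    rw [ht]; push_cast
    exact (Nat.le_ceil _).trans (le_add_of_nonneg_right zero_le_one)
  set A₁ : ℝ := 1 + 2 * E * (ρfac : ℝ) * ((ℓ : ℝ) + 1) ^ 3 * t with hA₁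
  have hA₁1 : 1 ≤ A₁ := by
    have h0 : (0 : ℝ) ≤ 2 * E * (ρfac : ℝ) * ((ℓ : ℝ) + 1) ^ 3 * t := by positivity
    rw [hA₁]; linarith
  refine ⟨2 * B₀ * A₁, ρ₀, M₀, N₀, max R₀ ((1 + 4 * (t ^ 2 * ρfac)) * (ℓ + 1) + 3), by positivity, ?_⟩
  intro η hη a M ρ k s R hk hM0 hρdiv hMdiv hRρ hR0' hN01 hρ0 m hm1 hmk φ hLan hsupp N hN0 hJ hQcov hout
  have hR0 : R₀ ≤ R := le_trans (le_max_left _ _) hR0'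
  have hwide : (1 + 4 * (t ^ 2 * ρfac)) * (ℓ + 1) + 3 ≤ ρ :=
    (le_trans (le_max_right _ _) hR0').trans (le_trans (Nat.le_mul_of_pos_right _ (by positivity)) hRρ)
  -- ### the bootstrap quantity `G` and the enlarged straight datum `N′`
  obtain ⟨G, hG0, hGub, hGlub⟩ := exists_weighted_max hoddL η a M ρ k m hmk φ
  set Ξ : ℝ := E * (2 * ((ℓ : ℝ) + 1) ^ 2 * G + (t : ℝ) ^ 2 * (ρfac : ℝ) * ((ℓ : ℝ) + 1) ^ 3 * N) / t with hΞ
  have hΞ0 : 0 ≤ Ξ := by positivity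
  set N' : ℝ := N + 2 * Ξ with hN'
  have hNN' : N ≤ N' := by rw [hN']; linarith
  have hN'0 : 0 ≤ N' := hN0.trans hNN'
  -- ### the straight datum: `‖Ŷ_j(iηφ)(c)‖ ≤ N′` on print's class
  have hQ : ∀ j, j ≤ m → ∀ c ∈ cubeLamBPZ (ℓ + 1) a M ρ k m j, ‖linQIterZ (ℓ + 1) (iEta η φ) j c.1 c.2‖ ≤ N' := by
    intro j hjm c hc
    have hcov := hQcov j hjm c hc
    have hid := linCovIterZ_one_eq (ℓ + 1) hLs (iEta η φ) j c.1 c.2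
    set Θ := carryIter (fun _ θ w' => rlamZ (ℓ + 1) (1 : SiteZ (d + 1) → Fin (d + 1) → ℂˣ) θ (((ℓ + 1 : ℕ) : ℤ) • w'))
      (fun _ A w' => lamZ (ℓ + 1) (1 : SiteZ (d + 1) → Fin (d + 1) → ℂˣ) A (((ℓ + 1 : ℕ) : ℤ) • w')) (linQIterZ (ℓ + 1) (iEta η φ)) with hΘ
    have hsplit : linQIterZ (ℓ + 1) (iEta η φ) j c.1 c.2 =
        linCovIterZ (ℓ + 1) 1 (iEta η φ) j c.1 c.2 - dcovF (1 : SiteZ (d + 1) → Fin (d + 1) → ℂˣ) (Θ j) c.1 c.2 := by rw [hid]; abel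
    have hbound : ‖Θ j c.1‖ + ‖Θ j (c.1 + e c.2)‖ ≤ 2 * Ξ := by
      rcases j with _ | j₀
      · rw [hΘ, carryIter_zero]; simp only [Pi.zero_apply, norm_zero, add_zero]; positivity
      · obtain ⟨w, hw, hz1, hz2⟩ := exists_near_of_mem_cubeLamBPZ hc
        have hρw : (ℓ + 1) ^ (j₀ + 1) + (4 * (t ^ 2 * (((d + 1) * sL + 2 * (ℓ + 1)) * (ℓ + 1) ^ (j₀ + 1))) + 3) ≤ ρ * (ℓ + 1) ^ j₀ := by
          have hLj : 1 ≤ (ℓ + 1) ^ j₀ := Nat.one_le_pow _ _ (by omega)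
          have h1 : ((1 + 4 * (t ^ 2 * ρfac)) * (ℓ + 1) + 3) * (ℓ + 1) ^ j₀ ≤ ρ * (ℓ + 1) ^ j₀ := Nat.mul_le_mul_right _ hwide
          have h2 : (ℓ + 1) ^ (j₀ + 1) + (4 * (t ^ 2 * (((d + 1) * sL + 2 * (ℓ + 1)) * (ℓ + 1) ^ (j₀ + 1))) + 3) ≤
              ((1 + 4 * (t ^ 2 * ρfac)) * (ℓ + 1) + 3) * (ℓ + 1) ^ j₀ :=
            calc (ℓ + 1) ^ (j₀ + 1) + (4 * (t ^ 2 * (((d + 1) * sL + 2 * (ℓ + 1)) * (ℓ + 1) ^ (j₀ + 1))) + 3)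
                ≤ (ℓ + 1) ^ (j₀ + 1) + (4 * (t ^ 2 * (((d + 1) * sL + 2 * (ℓ + 1)) * (ℓ + 1) ^ (j₀ + 1))) + 3 * (ℓ + 1) ^ j₀) := by linarith
              _ = ((1 + 4 * (t ^ 2 * ρfac)) * (ℓ + 1) + 3) * (ℓ + 1) ^ j₀ := by rw [hρfac]; ring
          exact h2.trans h1
        have h1 := norm_carried_iEta_le hd2 hLs (by omega) hoddL hC0 hC hη φ a M ρ k m hmk hN0 hJ hG0 hGub t ht1 hjm hρw c.1 w hw hz1
        have h2 := norm_carried_iEta_le hd2 hLs (by omega) hoddL hC0 hC hη φ a M ρ k m hmk hN0 hJ hG0 hGub t ht1 hjm hρw (c.1 + e c.2) w hw hz2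
        have hΞ' : (((d + 1 : ℕ) : ℝ) * sL) ^ 2 * C * (2 * (((ℓ + 1 : ℕ) : ℝ)) ^ 2 * G + (t : ℝ) ^ 2 * (((d + 1 : ℕ) : ℝ) * sL + 2 * ((ℓ + 1 : ℕ) : ℝ)) * (((ℓ + 1 : ℕ) : ℝ)) ^ 3 * N) / t = Ξ := by
          rw [hΞ, hE, hρfac]; push_cast; ring
        rw [hΞ'] at h1 h2
        rw [hΘ]
        linarith
    calc ‖linQIterZ (ℓ + 1) (iEta η φ) j c.1 c.2‖
        = ‖linCovIterZ (ℓ + 1) 1 (iEta η φ) j c.1 c.2 - dcovF (1 : SiteZ (d + 1) → Fin (d + 1) → ℂˣ) (Θ j) c.1 c.2‖ := by rw [hsplit]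
      _ ≤ ‖linCovIterZ (ℓ + 1) 1 (iEta η φ) j c.1 c.2‖ + ‖dcovF (1 : SiteZ (d + 1) → Fin (d + 1) → ℂˣ) (Θ j) c.1 c.2‖ := norm_sub_le _ _
      _ ≤ N + (‖Θ j c.1‖ + ‖Θ j (c.1 + e c.2)‖) := add_le_add hcov (norm_dcovF_one_le _ _ _)
      _ ≤ N + 2 * Ξ := by linarith
  -- ### the straight fact at datum `N′`
  have hJ' : ∀ j, j ≤ m → ∀ (y : SiteZ (d + 1)) (τ : Fin (d + 1)), BondTouches (cubeFamZ false (ℓ + 1) a M ρ k j) y τ →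
      ((((ℓ + 1 : ℕ) : ℝ)) ^ j * η) ^ 3 * ‖Jcur η (1 : SiteZ (d + 1) → Fin (d + 1) → ℂˣ) φ τ y‖ ≤ N' :=
    fun j hj y τ hb => (hJ j hj y τ hb).trans hNN'
  have hout' : ∀ (y : SiteZ (d + 1)) (τ : Fin (d + 1)), ¬ BondTouches (cubeFamZ false (ℓ + 1) a M ρ k 0) y τ → η * ‖φ y τ‖ ≤ N' :=
    fun y τ hb => (hout y τ hb).trans hNN'
  have HS' := HS η hη a M ρ k s R hk hM0 hρdiv hMdiv hRρ hR0 hN01 hρ0 m hm1 hmk φ hLan hsupp N' hN'0 hJ' hQ hout'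
  -- ### `G ≤ B₀N′`, a contraction
  have hGle : G ≤ B₀ * N' := hGlub (B₀ * N') (by positivity) fun j hj y τ ν hside => (HS' j hj y τ hside).2.1 ν
  have hcoef : B₀ * (4 * E * ((ℓ : ℝ) + 1) ^ 2 / t) ≤ 1 / 2 := by
    rw [← mul_div_assoc, div_le_iff₀ htr]
    linarith
  set D : ℝ := 2 * B₀ * E * (ρfac : ℝ) * ((ℓ : ℝ) + 1) ^ 3 * t with hD
  have hexp : B₀ * N' = B₀ * N + B₀ * (4 * E * ((ℓ : ℝ) + 1) ^ 2 / t) * G + D * N := by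
    rw [hN', hΞ, hD]; field_simp; ring
  have hcG : B₀ * (4 * E * ((ℓ : ℝ) + 1) ^ 2 / t) * G ≤ 1 / 2 * G := mul_le_mul_of_nonneg_right hcoef hG0
  have hG2 : G ≤ 2 * B₀ * N + 2 * D * N := by linarith
  have hfinal : B₀ * N' ≤ 2 * B₀ * A₁ * N := by
    have hkey : B₀ * N' ≤ 2 * B₀ * N + 2 * D * N := by linarith
    calc B₀ * N' ≤ 2 * B₀ * N + 2 * D * N := hkey
      _ = 2 * B₀ * A₁ * N := by rw [hA₁, hD]; ring
  -- ### conclusion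
  intro j hjm y τ hside
  obtain ⟨h1, h2, h3⟩ := HS' j hjm y τ hside
  exact ⟨h1.trans hfinal, fun ν => (h2 ν).trans hfinal, h3.trans hfinal⟩

/-- ★★★ **[Balaban1985RegularSpaces] (1.59) ∕ (1.62) AT `U₀ = 1` FOR THE RECORD's LINEARISED AVERAGING `linCovIterZ L 1` ON THE CENTRED CUBE MEMBER — UNCONDITIONAL for every odd
`L = ℓ + 1 ≥ 5`**: the named fact `B8Ineq159FlatCovPrintedRec.Ineq159FlatCubeMemberCovPrintedZ (d+1) (ℓ+1)` (dag-n05-e g39 INTENT-8), by the bootstrap `cov_of_straight` from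
dag-n05-e g38's proved straight twin `ineq159FlatCubeMemberPrintedZ_holds`. [cite: Balaban1985RegularSpaces, (1.59) p.86, (1.62) p.87; Balaban1985BackgroundPropagators, (3.14)–(3.15) p.393, Thm 3.3 p.399;
Balaban1985Averaging, (89)–(92) p.31, (127) p.37; Balaban1987RG1, (0.3)–(0.4) pp.252–253] -/
theorem ineq159FlatCubeMemberCovPrintedZ_holds (d ℓ : ℕ) (hℓ : 4 ≤ ℓ) (hodd : Odd (ℓ + 1)) : Ineq159FlatCubeMemberCovPrintedZ (d + 1) (ℓ + 1) :=
  cov_of_straight d ℓ hℓ hodd (ineq159FlatCubeMemberPrintedZ_holds d ℓ hℓ hodd)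

end Bootstrap

end Literature.MathematicalPhysics.QuantumFieldTheory.Balaban1983to89.B8Ineq159FlatCovCubeMemberRec

end
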